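import Literature.AlgebraicTopology.FundamentalGroup.PuncturedTorusFundamentalGroup
import Literature.AlgebraicTopology.FundamentalGroup.PuncturedTorusWedgeRetract
import HarnessLib

/-!
# The fundamental group of the figure eight (wedge of the two edge circles of the torus) is free of rank two

Topic `Literature/AlgebraicTopology/FundamentalGroup`.  For the real torus `T = (ℝ/ℤ)^ι` with exactly
two indices `i₀ ≠ i₁` and `x₀ ∈ T`, the WEDGE OF ITS TWO EDGE CIRCLES
`W(x₀) = {p | ∃ i, p i - x₀ i = ½} = {p | p i₀ = x₀ i₀ + ½} ∪ {p | p i₁ = x₀ i₁ + ½}` — two circles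
meeting in the single point `(x₀ i + ½)ᵢ`, i.e. a figure eight `S¹ ∨ S¹` — has free fundamental group
of rank two at every base point:

* `nonempty_mulEquiv_freeGroup_torusWedge` — `π₁(W(x₀), w) ≅ F₂`.

A. Hatcher, *Algebraic Topology* (2002), §1.2, Example 1.21 (`π₁(S¹ ∨ S¹) ≅ ℤ ∗ ℤ`, van Kampen) and
Ch. 0, Exercise 1 (p. 18: the torus with one point deleted deformation retracts onto the figure
eight).  Here it is the composite of the tree's `PuncturedTorus.bijective_inclHom_wedge_compl_singleton`
(`PuncturedTorusWedgeRetract.lean`: the inclusion `W(x₀) ↪ T ∖ {x₀}` is a `π₁`-isomorphism) with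
`PuncturedTorus.nonempty_mulEquiv_freeGroup_puncturedTorus` (`PuncturedTorusFundamentalGroup.lean`:
`π₁(T ∖ {x₀}) ≅ F₂`).  Proof-only; no definitions.

## References
* A. Hatcher, *Algebraic Topology*, CUP (2002), §1.2 Example 1.21; Ch. 0 Exercise 1 (p. 18);
  Prop. 1.17. [HatcherAT2002]
-/

noncomputable section

open Set Function

namespace Literature.AlgebraicTopology.FundamentalGroup

namespace PuncturedTorus

variable {ι : Type*} [Fintype ι] [DecidableEq ι] {i₀ i₁ : ι}

/-- **`π₁` of the figure eight is free of rank two**: for the wedge `W(x₀)` of the two edge circles of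
the torus `(ℝ/ℤ)^ι` (exactly two indices) and every base point `w ∈ W(x₀)`,
`π₁(W(x₀), w) ≅ F₂ = FreeGroup (Fin 2)`. [cite: HatcherAT2002, §1.2 Example 1.21; Ch. 0 Exercise 1 (p. 18)] -/
theorem nonempty_mulEquiv_freeGroup_torusWedge (hne : i₀ ≠ i₁) (hι : ∀ i, i = i₀ ∨ i = i₁)
    (x₀ : ι → AddCircle (1 : ℝ)) {w : ι → AddCircle (1 : ℝ)}
    (hw : w ∈ {p : ι → AddCircle (1 : ℝ) | ∃ i, p i - x₀ i = ((2⁻¹ : ℝ) : AddCircle (1 : ℝ))}) :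
    Nonempty (_root_.FundamentalGroup
        ({p : ι → AddCircle (1 : ℝ) | ∃ i, p i - x₀ i = ((2⁻¹ : ℝ) : AddCircle (1 : ℝ))} : Set _)
        ⟨w, hw⟩ ≃* FreeGroup (Fin 2)) := by
  -- the inclusion `W(x₀) ↪ T ∖ {x₀}` is a `π₁`-isomorphism (deformation retraction)
  let e₁ := MulEquiv.ofBijective _ (bijective_inclHom_wedge_compl_singleton x₀ hw)
  -- and `π₁(T ∖ {x₀}) ≅ F₂`
  obtain ⟨e₂⟩ := nonempty_mulEquiv_freeGroup_puncturedTorus hne hι x₀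
    ⟨w, wedge_subset_compl_singleton x₀ hw⟩
  exact ⟨e₁.trans e₂⟩

end PuncturedTorus

end Literature.AlgebraicTopology.FundamentalGroup

end
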